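import Literature.Geometry.Kaehler.ChartWindowTangentCone
import Literature.Geometry.Kaehler.HolomorphicChainAddProofs
import HarnessLib

/-!
# The tangent-cone chain of a holomorphic chain at a point

Let `T` be a holomorphic `p`-chain (`p = q + 1`) with support of pure dimension `p` on an open
subset `Ω` of a finite-dimensional complex inner product space `V`, `b ∈ Ω`, `F = limitCone |T| hb`
the limit cone of the support at `b`, `M` its regular part of dimension `p`, `C₁` the unit
tangent-cone chain and `D_r = (1/r)_*(τ_{-b})_*[T]` the blow-ups on the unit ball. By
`ChartWindowTangentCone.lean`, over every chart window of the tangent cone at a point `y ∈ M`,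
`‖y‖ < 1`, the blow-ups converge weakly, as `r → 0⁺`, to `c · [C₁]` with `c ∈ ℤ` the sheet number of
the window. This file turns the sheet numbers into King's tangent-cone chain
[Harvey1977, Thm. 1.31; Federer1969, 4.3.18–4.3.19; King 1971, Thm. 5.1.1]:

* `HolomorphicChain.IsTangentSheetNumber T hA hb y n` — the local weak-limit property
  "`D_r(ψ) → n · [C₁](ψ)` for all test forms `ψ` supported in some neighbourhood of `y`";
  `…unique` (two such integers at a point `y ∈ M` of the unit ball agree: test on the probe form of
  a small window at `y`, on which `[C₁]` is positive) and `…exists` (the sheet number of a window);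
* `HolomorphicChain.tangentSheetNumber T hA hb y` — **the sheet number of the tangent cone at
  `y`** (the integer so characterised, for `y ∈ M`, `‖y‖ < 1`); it is **locally constant on `M`**
  (`exists_nhds_tangentSheetNumber_eq`) and **constant on every component of `reg F` inside the
  unit ball** (`tangentSheetNumber_eq_of_mem_limitConeComp`; the part of a conic component inside the
  ball is connected, `isPreconnected_limitConeComp_inter_ball`); the sheet number of ANY window of the
  tangent cone at `y` is `tangentSheetNumber y` (`sheetNumber_eq_tangentSheetNumber`);
* `HolomorphicChain.tangentConeMult`, `HolomorphicChain.tangentConeChain T hA hb` — **the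
  tangent-cone chain `C(T, b)`**: the holomorphic `p`-chain on `V` carried by the conic components of
  the limit cone, the component through `y ∈ M ∩ B(0,1)` having multiplicity `tangentSheetNumber y`
  (`tangentConeMult_limitConeIrr`); its support is a complex cone
  (`tangentConeChain_smul_mem_support`);
* `HolomorphicChain.toCurrent_tangentConeChain_apply_eq` — near `y ∈ M ∩ B(0,1)`,
  `[C(T,b)] = tangentSheetNumber y · [C₁]`;
* `HolomorphicChain.tendsto_blowUp_apply_tangentConeChain` — **King's theorem in the weak topology,
  locally at the regular directions**: every `y ∈ M` with `‖y‖ < 1` has a neighbourhood `U` such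
  that `D_r(ψ) → [C(T,b)](ψ)` as `r → 0⁺` for all test forms `ψ` on the unit ball supported in `U`.

What remains of `Literature.Geometry.Kaehler.King1971_tangentCone` after this file: the passage
from the regular directions to all of `B(0,1)` (the bad set `F ∖ M` is `𝓗^{2p}`-null,
`LimitConeStructure.lean`) and from weak to locally flat convergence.

Definitions with bodies + theorems; no named facts.

## References

* R. Harvey, *Holomorphic chains and their boundaries*, PSPUM XXX.1 (1977), §1.10, Thm. 1.31
  [Harvey1977].
* H. Federer, *Geometric Measure Theory*, Springer 1969, 4.3.16–4.3.19 [Federer1969].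
* J. R. King, *The currents defined by analytic varieties*, Acta Math. 127 (1971), §5.
* E. M. Chirka, *Complex Analytic Sets*, Kluwer 1989, §5.4, §8.1 [Chirka1989].
-/

noncomputable section

open scoped Manifold Topology ENNReal NNReal InnerProductSpace ContDiff Distributions
open Set Filter MeasureTheory Metric Function Module TopologicalSpace

namespace Literature.Geometry.Kaehler

open Literature.Geometry.GeometricMeasureTheory

-- Nested operator-norm instances on (duals of) `V [⋀^Fin n]→L[ℝ] ℝ`.
set_option maxSynthPendingDepth 2

universe u

variable {V : Type u} [NormedAddCommGroup V] [InnerProductSpace ℂ V] [FiniteDimensional ℂ V]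

/-! ### The part of a conic component inside the unit ball is connected -/

section Connected

variable {Ω : Opens V} {A : Set Ω} {b : V} {p : ℕ}

omit [FiniteDimensional ℂ V] in
/-- **The part of a component of `reg F` inside the unit ball is preconnected**: it is the image of
the connected set `C(y) × (0, 1)` under `(z, t) ↦ (t/(‖z‖ + 1)) z` (components are invariant under
nonzero dilations). [cite: Chirka1989, §8.1] -/
theorem isPreconnected_limitConeComp_inter_ball (hb : b ∈ (Ω : Set V)) (y : (⊤ : Opens V)) :
    IsPreconnected {w : (⊤ : Opens V) | w ∈ limitConeComp A hb y ∧ ‖(w : V)‖ < 1} := by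
  set Φ : (⊤ : Opens V) × ℝ → (⊤ : Opens V) :=
    fun p => topSmul (((p.2 / (‖(p.1 : V)‖ + 1) : ℝ) : ℂ)) p.1 with hΦ
  have hΦc : Continuous Φ := by
    refine Continuous.subtype_mk ?_ _
    refine ((Complex.continuous_ofReal.comp ?_).smul (continuous_subtype_val.comp continuous_fst))
    exact continuous_snd.div ((continuous_norm.comp (continuous_subtype_val.comp continuous_fst)).add
      continuous_const) fun p => by positivity
  have himage : Φ '' (limitConeComp A hb y ×ˢ Ioo (0 : ℝ) 1) =
      {w : (⊤ : Opens V) | w ∈ limitConeComp A hb y ∧ ‖(w : V)‖ < 1} := by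
    refine Subset.antisymm ?_ ?_
    · rintro _ ⟨⟨z, t⟩, ⟨hz, ht⟩, rfl⟩
      have hzn : 0 ≤ ‖(z : V)‖ := norm_nonneg _
      have hcpos : 0 < t / (‖(z : V)‖ + 1) := div_pos ht.1 (by positivity)
      refine ⟨topSmul_mem_limitConeComp hz (by exact_mod_cast hcpos.ne'), ?_⟩
      show ‖((t / (‖(z : V)‖ + 1) : ℝ) : ℂ) • (z : V)‖ < 1
      rw [norm_smul, Complex.norm_real, Real.norm_of_nonneg hcpos.le, div_mul_eq_mul_div,
        div_lt_one (by positivity)]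
      nlinarith [ht.2]
    · rintro w ⟨hw, hw1⟩
      have hwn : 0 ≤ ‖(w : V)‖ := norm_nonneg _
      set lam : ℝ := 2 / (1 - ‖(w : V)‖) with hlam
      have hlam0 : 0 < lam := by rw [hlam]; exact div_pos two_pos (by linarith)
      set t : ℝ := (1 + ‖(w : V)‖) / 2 with ht
      refine ⟨⟨topSmul (lam : ℂ) w, t⟩, ⟨topSmul_mem_limitConeComp hw (by exact_mod_cast hlam0.ne'),
        ⟨by rw [ht]; positivity, by rw [ht]; linarith⟩⟩, ?_⟩
      apply Subtype.ext
      have hnorm : ‖((lam : ℂ) • (w : V))‖ = lam * ‖(w : V)‖ := by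
        rw [norm_smul, Complex.norm_real, Real.norm_of_nonneg hlam0.le]
      simp only [hΦ, coe_topSmul, hnorm, smul_smul]
      have hden : lam * ‖(w : V)‖ + 1 ≠ 0 := by positivity
      have hcoef : ((t / (lam * ‖(w : V)‖ + 1) : ℝ) : ℂ) * (lam : ℂ) = 1 := by
        rw [← Complex.ofReal_mul, show t / (lam * ‖(w : V)‖ + 1) * lam = 1 from ?_, Complex.ofReal_one]
        rw [div_mul_eq_mul_div, div_eq_one_iff_eq hden, ht, hlam]
        have h1 : (1 : ℝ) - ‖(w : V)‖ ≠ 0 := by linarith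
        field_simp
        ring
      rw [hcoef, one_smul]
  rw [← himage]
  exact ((isPreconnected_connectedComponentIn).prod isPreconnected_Ioo).image Φ hΦc.continuousOn

end Connected

namespace HolomorphicChain

variable [MeasurableSpace V] [BorelSpace V] {Ω : Opens V} {q : ℕ}

/-! ### The local weak-limit property -/

/-- **The local weak-limit property**: `n` is a tangent sheet number of `T` at `b` near the point
`y` of the unit ball if, for all test forms `ψ` supported in some neighbourhood of `y`, the blow-ups
satisfy `D_r(ψ) → n · [C₁](ψ)` as `r → 0⁺`, `C₁` the unit tangent-cone chain.
[cite: Harvey1977, Thm. 1.31; Federer1969, 4.3.18] -/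
def IsTangentSheetNumber (T : HolomorphicChain 𝓘(ℂ, V) Ω (q + 1))
    (hA : HasPureDim 𝓘(ℂ, V) T.support (q + 1)) {b : V} (hb : b ∈ (Ω : Set V)) (y : V) (n : ℤ) :
    Prop :=
  ∃ U : Set V, IsOpen U ∧ y ∈ U ∧ ∀ ψ : TestForm (unitBall V) (2 * (q + 1)), tsupport ⇑ψ ⊆ U →
    Tendsto (fun r => T.blowUp b r ψ) (𝓝[>] (0 : ℝ))
      (𝓝 ((n : ℝ) * (limitConeUnitChain hA hb).toCurrent (TestFunction.monoCLM ℝ ψ)))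

variable (T : HolomorphicChain 𝓘(ℂ, V) Ω (q + 1)) (hA : HasPureDim 𝓘(ℂ, V) T.support (q + 1))
  {b : V} (hb : b ∈ (Ω : Set V))

/-- The property passes to points of the witnessing neighbourhood. [folklore] -/
private theorem IsTangentSheetNumber.of_mem {y : V} {n : ℤ} {U : Set V} (hU : IsOpen U) (hz : y ∈ U)
    (h : ∀ ψ : TestForm (unitBall V) (2 * (q + 1)), tsupport ⇑ψ ⊆ U →
      Tendsto (fun r => T.blowUp b r ψ) (𝓝[>] (0 : ℝ))
        (𝓝 ((n : ℝ) * (limitConeUnitChain hA hb).toCurrent (TestFunction.monoCLM ℝ ψ)))) :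
    IsTangentSheetNumber T hA hb y n :=
  ⟨U, hU, hz, h⟩

omit [MeasurableSpace V] [BorelSpace V] in
/-- A real orthonormal basis of `K` adapted to a unitary one, and a dual covector. [folklore] -/
private theorem exists_frame_data (W : ChartWindow V) (hKp : finrank ℂ W.K = q + 1) :
    letI : InnerProductSpace ℝ W.K := InnerProductSpace.complexToReal
    ∃ (bK : OrthonormalBasis (Fin (q + 1)) ℂ W.K) (e : OrthonormalBasis (Fin (2 * (q + 1))) ℝ W.K)
      (om₀ : Covector V (2 * (q + 1))),
      ⇑e = complexFrame ⇑bK ∧ om₀ (fun i => ((e i : W.K) : V)) = 1 := by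
  letI : InnerProductSpace ℝ V := InnerProductSpace.complexToReal
  letI : InnerProductSpace ℝ W.K := InnerProductSpace.complexToReal
  set bK : OrthonormalBasis (Fin (q + 1)) ℂ W.K := (stdOrthonormalBasis ℂ W.K).reindex (finCongr hKp)
  obtain ⟨e, he⟩ := exists_orthonormalBasis_coe_eq_complexFrame bK
  have he' : Orthonormal ℝ fun i => ((e i : W.K) : V) := by
    have := e.orthonormal
    rw [orthonormal_iff_ite] at this ⊢
    intro i j
    rw [← this i j]
    rfl
  obtain ⟨om₀, hom₀⟩ := exists_covector_apply_eq_one he'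
  exact ⟨bK, e, om₀, he, hom₀⟩

omit [MeasurableSpace V] [BorelSpace V] in
/-- An open neighbourhood of `y ∈ M` in `V` on which the limit cone is the component through `y`.
[cite: Chirka1989, §5.3] -/
private theorem exists_open_component_nhds {y : (⊤ : Opens V)}
    (hy : y ∈ limitConeReg T.support hb (q + 1)) :
    ∃ N₀ : Set (⊤ : Opens V), IsOpen N₀ ∧ y ∈ N₀ ∧
      limitConeTop T.support hb ∩ N₀ = limitConeComp T.support hb y ∩ N₀ ∧
      IsOpen (((↑) : (⊤ : Opens V) → V) '' N₀) ∧ (y : V) ∈ ((↑) : (⊤ : Opens V) → V) '' N₀ := by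
  obtain ⟨N₀, hN₀o, hyN₀, hFN₀⟩ := exists_isOpen_limitConeTop_inter_eq (mem_limitConeComp_self hy)
  exact ⟨N₀, hN₀o, hyN₀, hFN₀, (⊤ : Opens V).2.isOpenMap_subtype_val N₀ hN₀o, ⟨y, hyN₀, rfl⟩⟩

/-- **Uniqueness of the tangent sheet number**: at a point `y ∈ M` of the unit ball, two integers
with the local weak-limit property coincide — test both limits on the probe form of a window of the
tangent cone at `y` inside both neighbourhoods, on which `[C₁]` is positive
(`ChartWindow.graphCurrent_probe_pos`, `graphCurrent_apply_eq_toCurrent_apply`).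
[cite: Harvey1977, Thm. 1.31; Federer1969, 4.3.18] -/
theorem IsTangentSheetNumber.unique {y : (⊤ : Opens V)} (hy : y ∈ limitConeReg T.support hb (q + 1))
    (hy1 : ‖(y : V)‖ < 1) {n₁ n₂ : ℤ} (h₁ : IsTangentSheetNumber T hA hb (y : V) n₁)
    (h₂ : IsTangentSheetNumber T hA hb (y : V) n₂) : n₁ = n₂ := by
  letI : InnerProductSpace ℝ V := InnerProductSpace.complexToReal
  obtain ⟨U₁, hU₁o, hyU₁, hU₁⟩ := h₁
  obtain ⟨U₂, hU₂o, hyU₂, hU₂⟩ := h₂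
  obtain ⟨N₀, -, -, hFN₀, hNo, hyN⟩ := exists_open_component_nhds T hb hy
  set ρ₀ : ℝ := (‖(y : V)‖ + 1) / 2 with hρ₀def
  have hρ₀ : ρ₀ < 1 := by rw [hρ₀def]; linarith
  have hyρ₀ : ‖(y : V)‖ < ρ₀ := by rw [hρ₀def]; linarith
  set O : Set V := U₁ ∩ U₂ ∩ ball (0 : V) ρ₀ ∩ ((↑) : (⊤ : Opens V) → V) '' N₀ with hO
  have hOo : IsOpen O := ((hU₁o.inter hU₂o).inter isOpen_ball).inter hNo
  have hyO : (y : V) ∈ O := ⟨⟨⟨hyU₁, hyU₂⟩, mem_ball_zero_iff.2 hyρ₀⟩, hyN⟩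
  obtain ⟨W, hm, hKp, hΨ0, -, -, hM, -, hTO, hΨO, hinn, hcar, -, htan, hFW, -⟩ :=
    T.exists_chartWindow_subset hA hb hy hOo hyO
  have hW : W.closedTube ⊆ closedBall (0 : V) ρ₀ :=
    hTO.trans (fun x hx => ball_subset_closedBall hx.1.2)
  obtain ⟨bK, e, om₀, he, hom₀⟩ := exists_frame_data W hKp
  obtain ⟨ψ, hψeq, hψsupp⟩ := W.exists_probe_testForm_unitBall hρ₀ hW hM om₀
  -- `[C₁](ψ) = [Γ](ψ) = I_W > 0`
  have hΨN : W.Ψ '' ball (0 : W.K) W.a₃ ⊆ ((↑) : (⊤ : Opens V) → V) '' N₀ :=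
    (image_mono (ball_subset_ball (W.a₃_lt.trans (W.a₂_lt.trans W.a₁_lt)).le)).trans
      (hΨO.trans fun x hx => hx.2)
  have hdens : ∀ x ∈ (limitConeUnitChain hA hb).carrier ∩ ((↑) : (⊤ : Opens V) → V) '' N₀,
      (limitConeUnitChain hA hb).density x = 1 := fun x hx =>
    density_limitConeUnitChain_eq_one_of_mem_carrier hA hb hy hFN₀ hx
  have hΓ := T.graphCurrent_apply_eq_toCurrent_apply hA hb W hKp bK e he hcar htan hFW hNo hΨN hdens
    (TestFunction.monoCLM ℝ ψ) (by
      rw [TestForm.monoCLM_apply_of_le (show unitBall V ≤ (⊤ : Opens V) from le_top)]; exact hψsupp)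
  have hpos := (W.graphCurrent_probe_pos hKp hM e om₀ hom₀).1
  rw [← hψeq, hΓ] at hpos
  -- both limits along `ψ`
  have hψO : tsupport ⇑ψ ⊆ O := hψsupp.trans (((W.innerCore_subset_core.trans W.core_subset_tube).trans
    W.tube_subset_closedTube).trans hTO)
  have hl₁ := hU₁ ψ (hψO.trans fun x hx => hx.1.1.1)
  have hl₂ := hU₂ ψ (hψO.trans fun x hx => hx.1.1.2)
  have heq := tendsto_nhds_unique hl₁ hl₂
  have := mul_right_cancel₀ hpos.ne' heq
  exact_mod_cast this

/-- **Windows certify the local weak-limit property**: the sheet number of a window of the tangent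
cone (with the eventual tube condition for every `η`, graph in `reg|C₁|`, `F ∩ closedTube = ` graph,
and `C₁` of density `1` near the graph) is a tangent sheet number at every point of its inner core.
[cite: Harvey1977, Thm. 1.31; Federer1969, 4.3.18] -/
theorem isTangentSheetNumber_of_window {r₀ : ℝ} (hr₀ : 0 < r₀) (hΩ : closedBall b r₀ ⊆ (Ω : Set V))
    (W : ChartWindow V) (hKp : finrank ℂ W.K = q + 1) {ρ₀ : ℝ} (hρ₀ : ρ₀ < 1)
    (hW : W.closedTube ⊆ closedBall (0 : V) ρ₀)
    (htube : ∀ r ∈ Ioo 0 r₀, T.blowUpSet b r ∩ W.closedTube ⊆ {x | ‖W.wf x‖ < W.τ / 16})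
    {M : ℝ} (hM0 : 0 ≤ M) (hM : ∀ k ∈ ball (0 : W.K) W.ρ, ‖fderiv ℂ W.Ψ k‖ ≤ M)
    (hτ : W.τ ≤ (W.a₁ ^ 2 - W.a₂ ^ 2) / (2 * W.ρ)) (bK : OrthonormalBasis (Fin (q + 1)) ℂ W.K)
    (e : letI : InnerProductSpace ℝ W.K := InnerProductSpace.complexToReal
      OrthonormalBasis (Fin (2 * (q + 1))) ℝ W.K)
    (he : ⇑e = complexFrame ⇑bK)
    {c : ℤ} (hsheet : ∀ r ∈ Ioo 0 r₀, ∃ hQr : (T.projPiece b r W hM).IsRepresentable,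
      hQr.restrictSet W.slab W.isOpen_slab.measurableSet =
        currentOfIntegration (W.slab ∩ {x | x - W.m ∈ W.K}) (fun _ => c)
          (fun _ => fun i => ((e i : W.K) : V)))
    (hfine : ∀ η : ℝ, 0 < η →
      ∀ᶠ r in 𝓝[>] (0 : ℝ), T.blowUpSet b r ∩ W.closedTube ⊆ {x | ‖W.wf x‖ < η})
    (hcar : ∀ k ∈ ball (0 : W.K) W.ρ, W.Ψ k ∈ (limitConeUnitChain hA hb).carrier)
    (htan : ∀ k ∈ ball (0 : W.K) W.ρ,
      approxTangentCone (2 * (q + 1)) ((μHE[2 * (q + 1)] : Measure V).restrict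
        (limitConeUnitChain hA hb).carrier) (W.Ψ k) = Set.range (fderiv ℂ W.Ψ k))
    (hFW : limitCone T.support hb ∩ W.closedTube ⊆ W.Ψ '' ball (0 : W.K) W.ρ)
    {N : Set V} (hN : IsOpen N) (hΨN : W.Ψ '' ball (0 : W.K) W.a₃ ⊆ N)
    (hdens : ∀ x ∈ (limitConeUnitChain hA hb).carrier ∩ N, (limitConeUnitChain hA hb).density x = 1)
    {z : V} (hz : z ∈ W.innerCore) : IsTangentSheetNumber T hA hb z c :=
  ⟨W.innerCore, W.isOpen_innerCore, hz, fun ψ hψ =>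
    T.tendsto_blowUp_apply_toCurrent_limitConeUnitChain hA hb hr₀ hΩ W hKp hρ₀ hW htube hM0 hM hτ bK e
      he hsheet hfine hcar htan hFW hN hΨN hdens ψ hψ⟩

/-- **Existence of the tangent sheet number** at every point `y ∈ M` of the unit ball: the sheet
number of a window of the tangent cone at `y` (`exists_chartWindow_subset`,
`HolomorphicChain.exists_sheetNumber`). [cite: Harvey1977, Thm. 1.31; Federer1969, 4.3.18] -/
theorem IsTangentSheetNumber.exists {y : (⊤ : Opens V)} (hy : y ∈ limitConeReg T.support hb (q + 1))
    (hy1 : ‖(y : V)‖ < 1) : ∃ n : ℤ, IsTangentSheetNumber T hA hb (y : V) n := by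
  letI : InnerProductSpace ℝ V := InnerProductSpace.complexToReal
  letI : InnerProductSpace ℝ (⊤ : Submodule ℂ V) := InnerProductSpace.complexToReal
  -- a closed ball around `b` inside `Ω`
  obtain ⟨R, hR, hRΩ⟩ := Metric.mem_nhds_iff.1 (Ω.isOpen.mem_nhds hb)
  have hΩ₀ : closedBall b (R / 2) ⊆ (Ω : Set V) := (closedBall_subset_ball (by linarith)).trans hRΩ
  -- a window at `y` inside `B(0, ρ₀)` and the component neighbourhood
  obtain ⟨N₀, -, -, hFN₀, hNo, hyN⟩ := exists_open_component_nhds T hb hy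
  set ρ₀ : ℝ := (‖(y : V)‖ + 1) / 2 with hρ₀def
  have hρ₀ : ρ₀ < 1 := by rw [hρ₀def]; linarith
  have hyρ₀ : ‖(y : V)‖ < ρ₀ := by rw [hρ₀def]; linarith
  set O : Set V := ball (0 : V) ρ₀ ∩ ((↑) : (⊤ : Opens V) → V) '' N₀ with hO
  have hOo : IsOpen O := isOpen_ball.inter hNo
  have hyO : (y : V) ∈ O := ⟨mem_ball_zero_iff.2 hyρ₀, hyN⟩
  obtain ⟨W, hm, hKp, hΨ0, -, -, hM, hτ, hTO, hΨO, hinn, hcar, -, htan, hFW, hFW0⟩ :=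
    T.exists_chartWindow_subset hA hb hy hOo hyO
  have hW : W.closedTube ⊆ closedBall (0 : V) ρ₀ := hTO.trans (fun x hx => ball_subset_closedBall hx.1)
  have hW1 : W.closedTube ⊆ closedBall (0 : V) 1 := hW.trans (closedBall_subset_closedBall hρ₀.le)
  obtain ⟨r₁, hr₁, hr₁R, htube⟩ :=
    T.exists_forall_Ioo_blowUpSet_inter_closedTube_subset_of_lt hb W hW1 hFW0 (R := R / 2) (by linarith)
  have hΩ₁ : closedBall b r₁ ⊆ (Ω : Set V) := (closedBall_subset_closedBall hr₁R).trans hΩ₀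
  have hfine := fun η (hη : (0 : ℝ) < η) => T.eventually_blowUpSet_inter_closedTube_subset hb W hW1 hFW0 hη
  obtain ⟨bK, e, om₀, he, -⟩ := exists_frame_data W hKp
  obtain ⟨c, hsheet⟩ := T.exists_sheetNumber hr₁ hΩ₁ W hKp hρ₀ hW htube hM bK e he
  have hΨN : W.Ψ '' ball (0 : W.K) W.a₃ ⊆ ((↑) : (⊤ : Opens V) → V) '' N₀ :=
    (image_mono (ball_subset_ball (W.a₃_lt.trans (W.a₂_lt.trans W.a₁_lt)).le)).trans
      (hΨO.trans fun x hx => hx.2)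
  have hdens : ∀ x ∈ (limitConeUnitChain hA hb).carrier ∩ ((↑) : (⊤ : Opens V) → V) '' N₀,
      (limitConeUnitChain hA hb).density x = 1 := fun x hx =>
    density_limitConeUnitChain_eq_one_of_mem_carrier hA hb hy hFN₀ hx
  exact ⟨c, T.isTangentSheetNumber_of_window hA hb hr₁ hΩ₁ W hKp hρ₀ hW htube (by norm_num) hM hτ bK e
    he hsheet hfine hcar htan hFW hNo hΨN hdens hinn⟩

/-! ### The sheet number of the tangent cone -/

/-- **The sheet number of the tangent cone of `T` at `b` in the direction `y`**: the integer `n`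
with `D_r(ψ) → n · [C₁](ψ)` for all test forms `ψ` supported near `y` (well defined for `y ∈ M`,
`‖y‖ < 1`; an arbitrary integer otherwise). [cite: Harvey1977, Thm. 1.31; King 1971, Thm. 5.1.1] -/
def tangentSheetNumber (y : V) : ℤ :=
  Classical.epsilon fun n : ℤ => IsTangentSheetNumber T hA hb y n

/-- The defining property of the tangent sheet number. [cite: Harvey1977, Thm. 1.31] -/
theorem isTangentSheetNumber_tangentSheetNumber {y : (⊤ : Opens V)}
    (hy : y ∈ limitConeReg T.support hb (q + 1)) (hy1 : ‖(y : V)‖ < 1) :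
    IsTangentSheetNumber T hA hb (y : V) (tangentSheetNumber T hA hb (y : V)) :=
  Classical.epsilon_spec (IsTangentSheetNumber.exists T hA hb hy hy1)

/-- Any integer with the local weak-limit property at `y` is the tangent sheet number.
[cite: Harvey1977, Thm. 1.31] -/
theorem IsTangentSheetNumber.eq_tangentSheetNumber {y : (⊤ : Opens V)}
    (hy : y ∈ limitConeReg T.support hb (q + 1)) (hy1 : ‖(y : V)‖ < 1) {n : ℤ}
    (h : IsTangentSheetNumber T hA hb (y : V) n) : n = tangentSheetNumber T hA hb (y : V) :=
  IsTangentSheetNumber.unique T hA hb hy hy1 h (isTangentSheetNumber_tangentSheetNumber T hA hb hy hy1)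

/-- **The sheet number of every window of the tangent cone is the tangent sheet number** at each
point of `M ∩ B(0,1)` in its inner core. [cite: Harvey1977, Thm. 1.31; Federer1969, 4.3.18] -/
theorem sheetNumber_eq_tangentSheetNumber {r₀ : ℝ} (hr₀ : 0 < r₀) (hΩ : closedBall b r₀ ⊆ (Ω : Set V))
    (W : ChartWindow V) (hKp : finrank ℂ W.K = q + 1) {ρ₀ : ℝ} (hρ₀ : ρ₀ < 1)
    (hW : W.closedTube ⊆ closedBall (0 : V) ρ₀)
    (htube : ∀ r ∈ Ioo 0 r₀, T.blowUpSet b r ∩ W.closedTube ⊆ {x | ‖W.wf x‖ < W.τ / 16})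
    {M : ℝ} (hM0 : 0 ≤ M) (hM : ∀ k ∈ ball (0 : W.K) W.ρ, ‖fderiv ℂ W.Ψ k‖ ≤ M)
    (hτ : W.τ ≤ (W.a₁ ^ 2 - W.a₂ ^ 2) / (2 * W.ρ)) (bK : OrthonormalBasis (Fin (q + 1)) ℂ W.K)
    (e : letI : InnerProductSpace ℝ W.K := InnerProductSpace.complexToReal
      OrthonormalBasis (Fin (2 * (q + 1))) ℝ W.K)
    (he : ⇑e = complexFrame ⇑bK)
    {c : ℤ} (hsheet : ∀ r ∈ Ioo 0 r₀, ∃ hQr : (T.projPiece b r W hM).IsRepresentable,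
      hQr.restrictSet W.slab W.isOpen_slab.measurableSet =
        currentOfIntegration (W.slab ∩ {x | x - W.m ∈ W.K}) (fun _ => c)
          (fun _ => fun i => ((e i : W.K) : V)))
    (hfine : ∀ η : ℝ, 0 < η →
      ∀ᶠ r in 𝓝[>] (0 : ℝ), T.blowUpSet b r ∩ W.closedTube ⊆ {x | ‖W.wf x‖ < η})
    (hcar : ∀ k ∈ ball (0 : W.K) W.ρ, W.Ψ k ∈ (limitConeUnitChain hA hb).carrier)
    (htan : ∀ k ∈ ball (0 : W.K) W.ρ,
      approxTangentCone (2 * (q + 1)) ((μHE[2 * (q + 1)] : Measure V).restrict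
        (limitConeUnitChain hA hb).carrier) (W.Ψ k) = Set.range (fderiv ℂ W.Ψ k))
    (hFW : limitCone T.support hb ∩ W.closedTube ⊆ W.Ψ '' ball (0 : W.K) W.ρ)
    {N : Set V} (hN : IsOpen N) (hΨN : W.Ψ '' ball (0 : W.K) W.a₃ ⊆ N)
    (hdens : ∀ x ∈ (limitConeUnitChain hA hb).carrier ∩ N, (limitConeUnitChain hA hb).density x = 1)
    {z : (⊤ : Opens V)} (hzM : z ∈ limitConeReg T.support hb (q + 1)) (hz1 : ‖(z : V)‖ < 1)
    (hz : (z : V) ∈ W.innerCore) : c = tangentSheetNumber T hA hb (z : V) :=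
  IsTangentSheetNumber.eq_tangentSheetNumber T hA hb hzM hz1
    (T.isTangentSheetNumber_of_window hA hb hr₀ hΩ W hKp hρ₀ hW htube hM0 hM hτ bK e he hsheet hfine hcar
      htan hFW hN hΨN hdens hz)

/-- **The tangent sheet number is locally constant on `M ∩ B(0,1)`.**
[cite: Harvey1977, Thm. 1.31; Federer1969, 4.3.18] -/
theorem exists_nhds_tangentSheetNumber_eq {y : (⊤ : Opens V)}
    (hy : y ∈ limitConeReg T.support hb (q + 1)) (hy1 : ‖(y : V)‖ < 1) :
    ∃ U : Set V, IsOpen U ∧ (y : V) ∈ U ∧ ∀ z : (⊤ : Opens V),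
      z ∈ limitConeReg T.support hb (q + 1) → ‖(z : V)‖ < 1 → (z : V) ∈ U →
        tangentSheetNumber T hA hb (z : V) = tangentSheetNumber T hA hb (y : V) := by
  obtain ⟨U, hUo, hyU, hU⟩ := isTangentSheetNumber_tangentSheetNumber T hA hb hy hy1
  refine ⟨U, hUo, hyU, fun z hzM hz1 hzU => ?_⟩
  exact (IsTangentSheetNumber.eq_tangentSheetNumber T hA hb hzM hz1 ⟨U, hUo, hzU, hU⟩).symm

/-- **The tangent sheet number is constant along every component of `reg F` inside the unit
ball** (locally constant on a preconnected set). [cite: Harvey1977, Thm. 1.31; Federer1969, 4.3.18] -/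
theorem tangentSheetNumber_eq_of_mem_limitConeComp {y z : (⊤ : Opens V)}
    (hy : y ∈ limitConeReg T.support hb (q + 1)) (hy1 : ‖(y : V)‖ < 1)
    (hz : z ∈ limitConeComp T.support hb y) (hz1 : ‖(z : V)‖ < 1) :
    tangentSheetNumber T hA hb (z : V) = tangentSheetNumber T hA hb (y : V) := by
  set S : Set (⊤ : Opens V) := {w | w ∈ limitConeComp T.support hb y ∧ ‖(w : V)‖ < 1} with hS
  have hSc : IsPreconnected S := isPreconnected_limitConeComp_inter_ball hb y
  set f : (⊤ : Opens V) → ℤ := fun w => tangentSheetNumber T hA hb (w : V) with hf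
  have hcont : ContinuousOn f S := by
    intro w hw
    have hwM : w ∈ limitConeReg T.support hb (q + 1) := limitConeComp_subset_limitConeReg hy hw.1
    obtain ⟨U, hUo, hwU, hU⟩ := T.exists_nhds_tangentSheetNumber_eq hA hb hwM hw.2
    have hev : f =ᶠ[𝓝[S] w] fun _ => f w := by
      have hmem : ((↑) : (⊤ : Opens V) → V) ⁻¹' U ∈ 𝓝[S] w :=
        mem_nhdsWithin_of_mem_nhds ((hUo.preimage continuous_subtype_val).mem_nhds hwU)
      filter_upwards [hmem, self_mem_nhdsWithin] with w' hw'U hw'S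
      exact hU w' (limitConeComp_subset_limitConeReg hy hw'S.1) hw'S.2 hw'U
    exact (continuousWithinAt_const.congr_of_eventuallyEq hev rfl)
  exact hSc.constant hcont ⟨hz, hz1⟩ ⟨mem_limitConeComp_self hy, hy1⟩

/-! ### The tangent-cone chain -/

/-- **The multiplicity of a conic component**: the tangent sheet number at any of its points inside
the unit ball (`0` on sets which are not conic components through such points).
[cite: Harvey1977, Thm. 1.31; King 1971, Thm. 5.1.1] -/
def tangentConeMult (Z : Set (⊤ : Opens V)) : ℤ :=
  open scoped Classical in
  if h : ∃ y : (⊤ : Opens V), y ∈ limitConeReg T.support hb (q + 1) ∧ ‖(y : V)‖ < 1 ∧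
      Z = limitConeIrr T.support hb y
  then tangentSheetNumber T hA hb (h.choose : V) else 0

/-- **The tangent-cone chain `C(T, b)`** of `T` at `b`: the holomorphic `p`-chain on `V` carried by
the conic components of the limit cone with the tangent sheet numbers as multiplicities.
[cite: Harvey1977, Thm. 1.31; Federer1969, 4.3.19; King 1971, Thm. 5.1.1] -/
def tangentConeChain : HolomorphicChain 𝓘(ℂ, V) (⊤ : Opens V) (q + 1) :=
  limitConeChain hA hb (tangentConeMult T hA hb)

/-- **The multiplicity of the conic component through `y ∈ M ∩ B(0,1)` is the tangent sheet number
at `y`.** [cite: Harvey1977, Thm. 1.31] -/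
theorem tangentConeMult_limitConeIrr {y : (⊤ : Opens V)} (hy : y ∈ limitConeReg T.support hb (q + 1))
    (hy1 : ‖(y : V)‖ < 1) :
    tangentConeMult T hA hb (limitConeIrr T.support hb y) = tangentSheetNumber T hA hb (y : V) := by
  classical
  have h : ∃ y' : (⊤ : Opens V), y' ∈ limitConeReg T.support hb (q + 1) ∧ ‖(y' : V)‖ < 1 ∧
      limitConeIrr T.support hb y = limitConeIrr T.support hb y' := ⟨y, hy, hy1, rfl⟩
  rw [tangentConeMult, dif_pos h]
  obtain ⟨hy'M, hy'1, hIrr⟩ := h.choose_spec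
  set y' := h.choose with hy'
  -- `y'` lies on the component through `y`
  have hcomp : limitConeComp T.support hb y' = limitConeComp T.support hb y :=
    limitConeComp_eq_of_limitConeIrr_inter_nonempty
      ⟨y, hIrr ▸ subset_closure (mem_limitConeComp_self hy), mem_limitConeComp_self hy⟩
  have hy'c : y' ∈ limitConeComp T.support hb y := hcomp ▸ mem_limitConeComp_self hy'M
  exact T.tangentSheetNumber_eq_of_mem_limitConeComp hA hb hy hy1 hy'c hy'1

/-- **The support of the tangent-cone chain is a complex cone** (invariant under every dilation
`x ↦ c • x`) — the homogeneity clause of King's theorem. [cite: Harvey1977, Thm. 1.31] -/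
theorem tangentConeChain_smul_mem_support {x : (⊤ : Opens V)}
    (hx : x ∈ (tangentConeChain T hA hb).support) (c : ℂ) :
    (⟨c • (x : V), trivial⟩ : (⊤ : Opens V)) ∈ (tangentConeChain T hA hb).support :=
  limitConeChain_smul_mem_support hA hb _ hx c

/-- The support of the tangent-cone chain lies in the limit cone ("whose support is a homogeneous
subvariety", contained in `Tan(spt T, b)`). [cite: Harvey1977, Thm. 1.31; Federer1969, 4.3.19] -/
theorem support_tangentConeChain_subset :
    (tangentConeChain T hA hb).support ⊆ limitConeTop T.support hb :=
  support_limitConeChain_subset hA hb _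

/-- The density of the tangent-cone chain on the component through `y ∈ M ∩ B(0,1)` is the tangent
sheet number at `y`. [cite: Harvey1977, Thm. 1.31] -/
theorem density_tangentConeChain_of_mem_limitConeComp {y x : (⊤ : Opens V)}
    (hy : y ∈ limitConeReg T.support hb (q + 1)) (hy1 : ‖(y : V)‖ < 1)
    (hx : x ∈ limitConeComp T.support hb y) :
    (tangentConeChain T hA hb).density (x : V) = tangentSheetNumber T hA hb (y : V) := by
  rw [tangentConeChain, density_limitConeChain_of_mem_limitConeComp hA hb _ hy hx,
    tangentConeMult_limitConeIrr T hA hb hy hy1]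

/-! ### The tangent-cone chain is `tangentSheetNumber · [C₁]` near the regular directions -/

/-- The support of the tangent-cone chain near `y ∈ M ∩ B(0,1)`: if the tangent sheet number at `y`
is nonzero it agrees with the limit cone on a component neighbourhood, otherwise it misses it.
[folklore] -/
private theorem support_tangentConeChain_inter {y : (⊤ : Opens V)}
    (hy : y ∈ limitConeReg T.support hb (q + 1)) (hy1 : ‖(y : V)‖ < 1) {N₀ : Set (⊤ : Opens V)}
    (hFN₀ : limitConeTop T.support hb ∩ N₀ = limitConeComp T.support hb y ∩ N₀) :
    (tangentSheetNumber T hA hb (y : V) ≠ 0 →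
      (tangentConeChain T hA hb).support ∩ N₀ = (limitConeUnitChain hA hb).support ∩ N₀) ∧
    (tangentSheetNumber T hA hb (y : V) = 0 → (tangentConeChain T hA hb).support ∩ N₀ = ∅) := by
  have hC₁ : (limitConeUnitChain hA hb).support ∩ N₀ = limitConeTop T.support hb ∩ N₀ := by
    refine Subset.antisymm (inter_subset_inter_left _ (support_limitConeUnitChain_subset hA hb)) ?_
    rw [hFN₀]
    rintro x ⟨hx, hxN⟩
    exact ⟨(mem_support_limitConeUnitChain_iff hA hb).2 ⟨y, hy, subset_closure hx⟩, hxN⟩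
  constructor
  · intro hn
    rw [hC₁]
    refine Subset.antisymm (inter_subset_inter_left _ (support_tangentConeChain_subset T hA hb)) ?_
    rw [hFN₀]
    rintro x ⟨hx, hxN⟩
    refine ⟨(mem_support_limitConeChain_iff hA hb _).2 ⟨y, hy, ?_, subset_closure hx⟩, hxN⟩
    rwa [tangentConeMult_limitConeIrr T hA hb hy hy1]
  · intro hn
    ext x
    simp only [mem_inter_iff, mem_empty_iff_false, iff_false, not_and]
    intro hx hxN
    obtain ⟨y', hy', hd, hxy'⟩ := (mem_support_limitConeChain_iff hA hb _).1 hx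
    have hxF : x ∈ limitConeTop T.support hb := support_tangentConeChain_subset T hA hb hx
    have hxc : x ∈ limitConeComp T.support hb y := (hFN₀.subset ⟨hxF, hxN⟩ : _).1
    have hcomp : limitConeComp T.support hb y' = limitConeComp T.support hb y :=
      limitConeComp_eq_of_limitConeIrr_inter_nonempty ⟨x, hxy', hxc⟩
    have hIrr : limitConeIrr T.support hb y' = limitConeIrr T.support hb y := by
      simp only [limitConeIrr, hcomp]
    rw [hIrr, tangentConeMult_limitConeIrr T hA hb hy hy1] at hd
    exact hd hn

/-- **`[C(T,b)] = tangentSheetNumber y · [C₁]` near `y ∈ M ∩ B(0,1)`**: on a component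
neighbourhood of `y` the tangent-cone chain and the unit tangent-cone chain have the same carrier and
orientation and densities `tangentSheetNumber y` and `1` (or the former has no support there).
[cite: Harvey1977, Thm. 1.31; Federer1969, 4.3.18] -/
theorem toCurrent_tangentConeChain_apply_eq {y : (⊤ : Opens V)}
    (hy : y ∈ limitConeReg T.support hb (q + 1)) (hy1 : ‖(y : V)‖ < 1) {N₀ : Set (⊤ : Opens V)}
    (hN₀ : IsOpen N₀) (hFN₀ : limitConeTop T.support hb ∩ N₀ = limitConeComp T.support hb y ∩ N₀)
    (ψ : TestForm (⊤ : Opens V) (2 * (q + 1)))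
    (hψ : tsupport ⇑ψ ⊆ ((↑) : (⊤ : Opens V) → V) '' N₀) :
    (tangentConeChain T hA hb).toCurrent ψ =
      (tangentSheetNumber T hA hb (y : V) : ℝ) * (limitConeUnitChain hA hb).toCurrent ψ := by
  letI : InnerProductSpace ℝ V := InnerProductSpace.complexToReal
  set C := tangentConeChain T hA hb with hC
  set C₁ := limitConeUnitChain hA hb with hC₁'
  set n := tangentSheetNumber T hA hb (y : V) with hn
  set G : Set V := ((↑) : (⊤ : Opens V) → V) '' N₀ with hG
  have hGo : IsOpen G := (⊤ : Opens V).2.isOpenMap_subtype_val N₀ hN₀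
  have hGm : MeasurableSet G := hGo.measurableSet
  have hdata := Harvey1977_isRectifiableData_toCurrent_holds V (⊤ : Opens V) (q + 1) C
  have hdata₁ := Harvey1977_isRectifiableData_toCurrent_holds V (⊤ : Opens V) (q + 1) C₁
  have hsuppψ : Function.support ⇑ψ ⊆ G := (subset_tsupport _).trans hψ
  -- restrict both currents to `G`
  have h1 : C.toCurrent ψ = (currentOfIntegration (C.carrier ∩ G) C.density C.orientationFrame :
      Current (⊤ : Opens V) (2 * (q + 1))) ψ := by
    rw [HolomorphicChain.toCurrent, ← hdata.isRepresentable.restrictSet_apply_of_support_subset hGm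
      hsuppψ, hdata.restrictSet_eq hGm]
  have h2 : C₁.toCurrent ψ = (currentOfIntegration (C₁.carrier ∩ G) C₁.density C₁.orientationFrame :
      Current (⊤ : Opens V) (2 * (q + 1))) ψ := by
    rw [HolomorphicChain.toCurrent, ← hdata₁.isRepresentable.restrictSet_apply_of_support_subset hGm
      hsuppψ, hdata₁.restrictSet_eq hGm]
  rw [h1, h2, currentOfIntegration_apply (hdata.inter hGm).2.2.2.1,
    currentOfIntegration_apply (hdata₁.inter hGm).2.2.2.1]
  obtain ⟨hne, heq0⟩ := support_tangentConeChain_inter T hA hb hy hy1 hFN₀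
  by_cases hn0 : n = 0
  · -- no support near `y`
    have hempty : C.carrier ∩ G = ∅ := by
      have h := heq0 hn0
      ext x
      simp only [mem_inter_iff, mem_empty_iff_false, iff_false, not_and]
      rintro ⟨x', hx', rfl⟩ ⟨x'', hx''N, hxx⟩
      have hx'N : x' ∈ N₀ := by
        have heq : x'' = x' := Subtype.ext hxx
        rw [← heq]; exact hx''N
      have : x' ∈ C.support ∩ N₀ := ⟨hx'.1, hx'N⟩
      rw [h] at this
      exact this
    rw [hempty, hn0]
    simp
  · -- same carrier and orientation on `G`, densities `n` and `1`
    have hsupp : C.support ∩ N₀ = C₁.support ∩ N₀ := hne hn0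
    have hcarr : C.carrier ∩ G = C₁.carrier ∩ G := C.carrier_inter_image_eq C₁ hN₀ hsupp
    rw [hcarr, ← integral_const_mul]
    refine setIntegral_congr_fun (C₁.measurableSet_carrier.inter hGm) fun x hx => ?_
    obtain ⟨hxc, ⟨x', hx'N, rfl⟩⟩ := hx
    have hframe : C.orientationFrame (x' : V) = C₁.orientationFrame (x' : V) :=
      C.orientationFrame_eq_of_support_inter_eq C₁ hN₀ hsupp hx'N
    have hxF : x' ∈ limitConeTop T.support hb := carrier_limitConeUnitChain_subset hA hb hxc
    have hxC : x' ∈ limitConeComp T.support hb y := (hFN₀.subset ⟨hxF, hx'N⟩ : _).1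
    have hdC : C.density (x' : V) = n := T.density_tangentConeChain_of_mem_limitConeComp hA hb hy hy1 hxC
    have hd₁ : C₁.density (x' : V) = 1 := density_limitConeUnitChain_of_mem_limitConeComp hA hb hy hxC
    rw [hframe, hdC, hd₁]
    push_cast
    ring

/-- **King's tangent-cone theorem in the weak topology, at the regular directions.** Every point
`y ∈ M` of the unit ball has an open neighbourhood `U` such that, for every test form `ψ` on the unit
ball supported in `U`, `D_r(ψ) → [C(T,b)](ψ)` as `r → 0⁺`, `C(T,b)` the tangent-cone chain.
[cite: Harvey1977, Thm. 1.31; Federer1969, 4.3.18–4.3.19] -/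
theorem tendsto_blowUp_apply_tangentConeChain {y : (⊤ : Opens V)}
    (hy : y ∈ limitConeReg T.support hb (q + 1)) (hy1 : ‖(y : V)‖ < 1) :
    ∃ U : Set V, IsOpen U ∧ (y : V) ∈ U ∧ ∀ ψ : TestForm (unitBall V) (2 * (q + 1)),
      tsupport ⇑ψ ⊆ U → Tendsto (fun r => T.blowUp b r ψ) (𝓝[>] (0 : ℝ))
        (𝓝 ((tangentConeChain T hA hb).toCurrent (TestFunction.monoCLM ℝ ψ))) := by
  obtain ⟨U, hUo, hyU, hU⟩ := isTangentSheetNumber_tangentSheetNumber T hA hb hy hy1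
  obtain ⟨N₀, hN₀o, -, hFN₀, hNo, hyN⟩ := exists_open_component_nhds T hb hy
  refine ⟨U ∩ ((↑) : (⊤ : Opens V) → V) '' N₀, hUo.inter hNo, ⟨hyU, hyN⟩, fun ψ hψ => ?_⟩
  have hψ' : tsupport ⇑(TestFunction.monoCLM ℝ ψ : TestForm (⊤ : Opens V) (2 * (q + 1))) ⊆
      ((↑) : (⊤ : Opens V) → V) '' N₀ := by
    rw [TestForm.monoCLM_apply_of_le (show unitBall V ≤ (⊤ : Opens V) from le_top)]
    exact hψ.trans inter_subset_right
  rw [T.toCurrent_tangentConeChain_apply_eq hA hb hy hy1 hN₀o hFN₀ _ hψ']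
  exact hU ψ (hψ.trans inter_subset_left)

end HolomorphicChain

end Literature.Geometry.Kaehler
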